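import Summits.QuantumFields.YangMills.Theorems.ThermalDescentMaxwellRungWindow

/-!
# `ThermalDescent` / `ZeroTemperatureFloors` BC5 rung — file 5/6: the slab mode at scale `ℓ` and the reflected smearing
# chain, generic in a window-pinched density

Tribunal-w seat `ym-td-bc5w-1` (planner, gen 2).  The six files `ThermalDescentMaxwellRung{Defs,Kernel,Images,Window,
Chain,Floors}` are the ≤ 400-line Theorems split of the crux workfile
`Cruxes/ZeroTemperatureFloors/Lines/rung_maxwell.lean` (commit 53ced2b6fc84): the thermal free Maxwell₄ field as a
DECIDED SEPARATING MODEL for the deciding crux `ZeroTemperatureFloors` (stmt-QuantumFields-25390) of route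
`ThermalDescent` — statement, dictionary and mechanism in `…Floors`.  Helper files (`--supports` the crux), close nothing;
route-independent (imports `Mathlib`, the Mathlib-only certificate `TreeLevelSkewnessVanishes`, `Literature…EuclideanAction`).

The mode `w_ℓ` (bump with centre `(ℓ/2)e₀`, radii `ℓ/16 < ℓ/8`; `tsupport ⊆ {ℓ/4 < x₀ < 3ℓ/4}`, `wfun_tsupport_slab`); `x` in its
support ball and `θy` in it force `x − y ∈ W_ℓ` (`sub_mem_W`).  For ANY measurable density `k ≥ 0` with `m ≤ k ≤ M` on `W_ℓ`
and any matrix covariance `G` with `tr G(z)G(−z) = k(z)`: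
`m (ℓ/16)⁸ vol(B₁)² ≤ ∫∫ w_ℓ(x) w_ℓ(θy) tr G(x−y)G(y−x)` (`ring2_floor`; Fubini measurability via
`StronglyMeasurable.integral_prod_right`, indicator domination, `Measure.addHaar_real_closedBall`).

NOTHING HERE PROVES `ZeroTemperatureFloors`, `NT`, or the Yang–Mills mass gap: free-field Gaussian analysis on `ℝ⁴`,
a witness (R3/RECORD framing) that the deciding crux has content of its own outside NT's printed regime.
[cite: OsterwalderSeilerAnnPhys1978, §2–3; Luscher1977; GlimmJaffe1987, §6.3, §7]
-/

set_option autoImplicit false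

open scoped SchwartzMap BigOperators Topology
open MeasureTheory Filter Topology Matrix Metric Set
open Literature.MathematicalPhysics.QuantumLattice

noncomputable section

namespace Summit.QuantumFields.YangMills.Theorems.ThermalDescent.MaxwellRung
open Summit.QuantumFields.YangMills.Theorems.SelfNormalisedSkewness.Negative

/-! ## §C The slab mode at scale `ℓ`: centre `(ℓ/2)e₀`, radii `ℓ/16 < ℓ/8` -/

/-- The centre has time coordinate `ℓ/2`. [this route] -/
@[simp] theorem ctr_apply_zero (ℓ : ℝ) : ctr ℓ 0 = ℓ / 2 := by simp [ctr, e₀]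

/-- The centre is on the time axis (coordinate `1`). [this route] -/
@[simp] theorem ctr_apply_one (ℓ : ℝ) : ctr ℓ 1 = 0 := by simp [ctr, e₀]

/-- The centre is on the time axis (coordinate `2`). [this route] -/
@[simp] theorem ctr_apply_two (ℓ : ℝ) : ctr ℓ 2 = 0 := by simp [ctr, e₀]

/-- The centre is on the time axis (coordinate `3`). [this route] -/
@[simp] theorem ctr_apply_three (ℓ : ℝ) : ctr ℓ 3 = 0 := by simp [ctr, e₀]

/-- Inner radius `ℓ/16`. [this route] -/
@[simp] theorem bump_rIn (ℓ : ℝ) (hℓ : 0 < ℓ) : (bump ℓ hℓ).rIn = ℓ / 16 := rfl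

/-- Outer radius `ℓ/8`. [this route] -/
@[simp] theorem bump_rOut (ℓ : ℝ) (hℓ : 0 < ℓ) : (bump ℓ hℓ).rOut = ℓ / 8 := rfl

/-- The mode is the bump, pointwise. [this route] -/
@[simp] theorem wfun_apply (ℓ : ℝ) (hℓ : 0 < ℓ) (x : E4) : wfun ℓ hℓ x = bump ℓ hℓ x := rfl

/-- The mode is non-negative. [this route] -/
theorem wfun_nonneg {ℓ : ℝ} (hℓ : 0 < ℓ) (z : E4) : 0 ≤ wfun ℓ hℓ z := (bump ℓ hℓ).nonneg' z

/-- The mode is bounded by `1` (sup-normalised). [this route] -/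
theorem wfun_le_one {ℓ : ℝ} (hℓ : 0 < ℓ) (z : E4) : wfun ℓ hℓ z ≤ 1 := (bump ℓ hℓ).le_one

section Geometry

variable {ℓ : ℝ}

/-- Points of the support ball have time coordinate in `[3ℓ/8, 5ℓ/8]`. [this route] -/
theorem time_mem_of_mem {x : E4} (hx : x ∈ closedBall (ctr ℓ) (ℓ / 8)) :
    3 * ℓ / 8 ≤ x 0 ∧ x 0 ≤ 5 * ℓ / 8 := by
  rw [mem_closedBall, dist_eq_norm] at hx
  have h1 : |(x - ctr ℓ) 0| ≤ ‖x - ctr ℓ‖ := abs_apply_le_norm _ 0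
  have h2 : (x - ctr ℓ) 0 = x 0 - ℓ / 2 := by simp
  rw [h2] at h1
  obtain ⟨h3, h4⟩ := abs_le.mp (h1.trans hx)
  constructor <;> linarith

/-- Points of the support ball have spatial radius `≤ ℓ/8`. [this route] -/
theorem spSq_le_of_mem {x : E4} (hx : x ∈ closedBall (ctr ℓ) (ℓ / 8)) : spSq x ≤ (ℓ / 8) ^ 2 := by
  rw [mem_closedBall, dist_eq_norm] at hx
  have h1 : spSq (x - ctr ℓ) = spSq x := by simp [spSq]
  have h2 : spSq (x - ctr ℓ) ≤ nsq (x - ctr ℓ) := by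
    rw [nsq_eq_time_add_spSq]; nlinarith [sq_nonneg ((x - ctr ℓ) 0)]
  rw [nsq_eq_norm_sq, h1] at h2
  have h3 : ‖x - ctr ℓ‖ ^ 2 ≤ (ℓ / 8) ^ 2 := pow_le_pow_left₀ (norm_nonneg _) hx 2
  linarith

/-- Time reflection preserves the spatial radius. [folklore] -/
theorem spSq_timeReflection (y : E4) : spSq (timeReflection 4 y) = spSq y := by
  simp [spSq, timeReflection_apply]

/-- **The mode geometry lands in the window**: `x` in the support ball and `θy` in it force
`x − y ∈ W_ℓ`. [this route] -/
theorem sub_mem_W {x y : E4} (hx : x ∈ closedBall (ctr ℓ) (ℓ / 8))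
    (hy : timeReflection 4 y ∈ closedBall (ctr ℓ) (ℓ / 8)) : x - y ∈ W ℓ := by
  obtain ⟨hx1, hx2⟩ := time_mem_of_mem hx
  obtain ⟨hy1, hy2⟩ := time_mem_of_mem hy
  rw [show timeReflection 4 y 0 = -y 0 by simp [timeReflection_apply]] at hy1 hy2
  have hsx := spSq_le_of_mem hx
  have hsy := spSq_le_of_mem hy
  rw [spSq_timeReflection] at hsy
  have hsub : spSq (x - y) ≤ 2 * spSq x + 2 * spSq y := by
    simp only [spSq, PiLp.sub_apply]
    nlinarith [sq_nonneg (x 1 + y 1), sq_nonneg (x 2 + y 2), sq_nonneg (x 3 + y 3)]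
  simp only [W, Set.mem_setOf_eq, PiLp.sub_apply]
  refine ⟨by linarith, by linarith, by nlinarith⟩

/-- Reflected balls: `y ∈ B̄(θc, r) ↔ θy ∈ B̄(c, r)`. [folklore] -/
theorem mem_reflBall {y c : E4} {r : ℝ} :
    y ∈ closedBall (timeReflection 4 c) r ↔ timeReflection 4 y ∈ closedBall c r := by
  rw [mem_closedBall, mem_closedBall, ← (timeReflection 4).dist_map y, timeReflection_timeReflection]

/-- Constants are integrable on closed balls. [folklore] -/
theorem integrable_indicator_closedBall (c : E4) (r C : ℝ) :
    Integrable ((closedBall c r).indicator fun _ : E4 => C) := by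
  refine IntegrableOn.integrable_indicator ?_ measurableSet_closedBall
  exact integrableOn_const (measure_closedBall_lt_top).ne

/-- Volumes of balls of radius `r`: `r⁴ · vol B(0,1)`. [folklore] -/
theorem volume_real_closedBall (c : E4) {r : ℝ} (hr : 0 ≤ r) :
    (volume : Measure E4).real (closedBall c r) = r ^ 4 * (volume : Measure E4).real (ball 0 1) := by
  rw [Measure.addHaar_real_closedBall volume c hr, finrank_euclideanSpace_fin]

/-- The support of the mode lies in the open time slab `(ℓ/4, 3ℓ/4)` (so `δ₁ = ℓ/4 > 0`). [this route] -/
theorem wfun_tsupport_slab (hℓ : 0 < ℓ) :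
    tsupport (wfun ℓ hℓ : E4 → ℝ) ⊆ {y | ℓ / 4 < y 0 ∧ y 0 < 3 * ℓ / 4} := by
  intro x hx
  change x ∈ tsupport (bump ℓ hℓ) at hx
  rw [(bump ℓ hℓ).tsupport_eq, bump_rOut] at hx
  obtain ⟨h1, h2⟩ := time_mem_of_mem hx
  exact ⟨by linarith, by linarith⟩

end Geometry

/-! ## §D The smearing chain, generic in a window-pinched density `k`

For a measurable density `k ≥ 0` with `m ≤ k ≤ M` on the window `W_ℓ`, the reflected two-point
smearing `∫∫ w(x) w(θy) k(x − y)` of the mode is at least `m · vol B̄(θc, ℓ/16) · vol B̄(c, ℓ/16)`. -/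

section Chain

variable {ℓ : ℝ} (hℓ : 0 < ℓ) (k : E4 → ℝ) {m M : ℝ}

/-- The two-point density is non-negative. [this route] -/
theorem dens2_nonneg (hk0 : ∀ z, 0 ≤ k z) (x y : E4) : 0 ≤ dens2 hℓ k x y :=
  mul_nonneg ((bump ℓ hℓ).nonneg' _) (hk0 _)

/-- Domination on the window by a constant times the indicator of the reflected support ball.
[this route] -/
theorem dens2_le (hk0 : ∀ z, 0 ≤ k z) (hkM : ∀ z ∈ W ℓ, k z ≤ M) {x : E4}
    (hx : x ∈ closedBall (ctr ℓ) (ℓ / 8)) (y : E4) :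
    ‖dens2 hℓ k x y‖ ≤ (closedBall (timeReflection 4 (ctr ℓ)) (ℓ / 8)).indicator (fun _ => M) y := by
  rw [Real.norm_of_nonneg (dens2_nonneg hℓ k hk0 x y)]
  by_cases hy : y ∈ closedBall (timeReflection 4 (ctr ℓ)) (ℓ / 8)
  · rw [indicator_of_mem hy]
    have hy' := (mem_reflBall).1 hy
    unfold dens2
    calc bump ℓ hℓ (timeReflection 4 y) * k (x - y) ≤ 1 * M :=
          mul_le_mul (bump ℓ hℓ).le_one (hkM _ (sub_mem_W hx hy')) (hk0 _) zero_le_one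
      _ = M := one_mul _
  · rw [indicator_of_notMem hy]
    have hy' : timeReflection 4 y ∉ closedBall (ctr ℓ) (ℓ / 8) := fun h => hy (mem_reflBall.2 h)
    unfold dens2
    have hb : bump ℓ hℓ (timeReflection 4 y) = 0 :=
      (bump ℓ hℓ).zero_of_le_dist (by rw [mem_closedBall, not_le] at hy'; exact hy'.le)
    rw [hb, zero_mul]

/-- Joint measurability of the two-point density. [this route] -/
theorem measurable_dens2_uncurry (hk : Measurable k) : Measurable (Function.uncurry (dens2 hℓ k)) := by
  have h1 : Measurable fun p : E4 × E4 => bump ℓ hℓ (timeReflection 4 p.2) :=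
    ((bump ℓ hℓ).continuous.comp ((timeReflection 4).continuous.comp continuous_snd)).measurable
  have h2 : Measurable fun p : E4 × E4 => k (p.1 - p.2) := hk.comp (measurable_fst.sub measurable_snd)
  exact h1.mul h2

/-- Measurability of the two-point density in `y`. [this route] -/
theorem measurable_dens2 (hk : Measurable k) (x : E4) : Measurable (dens2 hℓ k x) := by
  have h1 : Measurable fun y : E4 => bump ℓ hℓ (timeReflection 4 y) :=
    ((bump ℓ hℓ).continuous.comp (timeReflection 4).continuous).measurable
  have h2 : Measurable fun y : E4 => k (x - y) := hk.comp (measurable_const.sub measurable_id)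
  exact h1.mul h2

/-- For `x` in the support ball the density is integrable in `y`. [this route] -/
theorem integrable_dens2 (hk : Measurable k) (hk0 : ∀ z, 0 ≤ k z) (hkM : ∀ z ∈ W ℓ, k z ≤ M)
    {x : E4} (hx : x ∈ closedBall (ctr ℓ) (ℓ / 8)) : Integrable (dens2 hℓ k x) :=
  Integrable.mono' (integrable_indicator_closedBall _ _ _) (measurable_dens2 hℓ k hk x).aestronglyMeasurable
    (Eventually.of_forall (dens2_le hℓ k hk0 hkM hx))

/-- The smeared density is non-negative. [this route] -/
theorem innerI_nonneg (hk0 : ∀ z, 0 ≤ k z) (x : E4) : 0 ≤ innerI hℓ k x :=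
  integral_nonneg (dens2_nonneg hℓ k hk0 x)

/-- The smeared density is bounded by `M · vol B̄(θc, ℓ/8)` on the support ball. [this route] -/
theorem innerI_le (hk0 : ∀ z, 0 ≤ k z) (hkM : ∀ z ∈ W ℓ, k z ≤ M) {x : E4}
    (hx : x ∈ closedBall (ctr ℓ) (ℓ / 8)) :
    ‖innerI hℓ k x‖ ≤ M * (volume : Measure E4).real (closedBall (timeReflection 4 (ctr ℓ)) (ℓ / 8)) := by
  unfold innerI
  calc ‖∫ y, dens2 hℓ k x y‖
        ≤ ∫ y, (closedBall (timeReflection 4 (ctr ℓ)) (ℓ / 8)).indicator (fun _ => M) y :=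
        norm_integral_le_of_norm_le (integrable_indicator_closedBall _ _ _)
          (Eventually.of_forall (dens2_le hℓ k hk0 hkM hx))
    _ = _ := by
        rw [integral_indicator_const _ measurableSet_closedBall, smul_eq_mul, mul_comm]

/-- The inner floor: for `x` in the INNER ball the smeared density is at least
`m · vol B̄(θc, ℓ/16)`. [this route] -/
theorem innerI_ge (hk : Measurable k) (hk0 : ∀ z, 0 ≤ k z) (hkm : ∀ z ∈ W ℓ, m ≤ k z)
    (hkM : ∀ z ∈ W ℓ, k z ≤ M) {x : E4} (hx : x ∈ closedBall (ctr ℓ) (ℓ / 16)) :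
    m * (volume : Measure E4).real (closedBall (timeReflection 4 (ctr ℓ)) (ℓ / 16)) ≤
      innerI hℓ k x := by
  have hx8 : x ∈ closedBall (ctr ℓ) (ℓ / 8) := closedBall_subset_closedBall (by linarith) hx
  unfold innerI
  calc m * (volume : Measure E4).real (closedBall (timeReflection 4 (ctr ℓ)) (ℓ / 16))
        = ∫ y, (closedBall (timeReflection 4 (ctr ℓ)) (ℓ / 16)).indicator (fun _ => m) y := by
        rw [integral_indicator_const _ measurableSet_closedBall, smul_eq_mul, mul_comm]
    _ ≤ ∫ y, dens2 hℓ k x y := by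
        refine integral_mono (integrable_indicator_closedBall _ _ _)
          (integrable_dens2 hℓ k hk hk0 hkM hx8) fun y => ?_
        by_cases hy : y ∈ closedBall (timeReflection 4 (ctr ℓ)) (ℓ / 16)
        · rw [indicator_of_mem hy]
          have hy' := (mem_reflBall).1 hy
          have hy8 : timeReflection 4 y ∈ closedBall (ctr ℓ) (ℓ / 8) :=
            closedBall_subset_closedBall (by linarith) hy'
          have hb : bump ℓ hℓ (timeReflection 4 y) = 1 :=
            (bump ℓ hℓ).one_of_mem_closedBall (by simpa using hy')
          show _ ≤ dens2 hℓ k x y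
          unfold dens2
          rw [hb, one_mul]
          exact hkm _ (sub_mem_W hx8 hy8)
        · rw [indicator_of_notMem hy]
          exact dens2_nonneg hℓ k hk0 x y

/-- The outer integrand is non-negative. [this route] -/
theorem outerF_nonneg (hk0 : ∀ z, 0 ≤ k z) (x : E4) : 0 ≤ outerF hℓ k x :=
  mul_nonneg ((bump ℓ hℓ).nonneg' _) (innerI_nonneg hℓ k hk0 x)

/-- The outer integrand is measurable (Fubini measurability of the inner integral). [this route] -/
theorem measurable_outerF (hk : Measurable k) : Measurable (outerF hℓ k) := by
  have h1 : Measurable fun x : E4 => bump ℓ hℓ x := (bump ℓ hℓ).continuous.measurable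
  have h2 : StronglyMeasurable (innerI hℓ k) :=
    StronglyMeasurable.integral_prod_right (f := dens2 hℓ k)
      (measurable_dens2_uncurry hℓ k hk).stronglyMeasurable
  exact h1.mul h2.measurable

/-- Domination of the outer integrand by a constant times the indicator of the support ball. [this route] -/
theorem outerF_le (hk0 : ∀ z, 0 ≤ k z) (hkM : ∀ z ∈ W ℓ, k z ≤ M) (x : E4) :
    ‖outerF hℓ k x‖ ≤ (closedBall (ctr ℓ) (ℓ / 8)).indicator
      (fun _ => M * (volume : Measure E4).real (closedBall (timeReflection 4 (ctr ℓ)) (ℓ / 8))) x := by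
  rw [Real.norm_of_nonneg (outerF_nonneg hℓ k hk0 x)]
  by_cases hx : x ∈ closedBall (ctr ℓ) (ℓ / 8)
  · rw [indicator_of_mem hx]
    unfold outerF
    have hI : innerI hℓ k x ≤ _ := (le_abs_self _).trans ((Real.norm_eq_abs _).symm.le.trans
      (innerI_le hℓ k hk0 hkM hx))
    calc bump ℓ hℓ x * innerI hℓ k x ≤ 1 * innerI hℓ k x :=
          mul_le_mul_of_nonneg_right (bump ℓ hℓ).le_one (innerI_nonneg hℓ k hk0 x)
      _ = innerI hℓ k x := one_mul _
      _ ≤ _ := hI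
  · rw [indicator_of_notMem hx]
    unfold outerF
    have hb : bump ℓ hℓ x = 0 :=
      (bump ℓ hℓ).zero_of_le_dist (by rw [mem_closedBall, not_le] at hx; exact hx.le)
    rw [hb, zero_mul]

/-- The outer integrand is integrable. [this route] -/
theorem integrable_outerF (hk : Measurable k) (hk0 : ∀ z, 0 ≤ k z) (hkM : ∀ z ∈ W ℓ, k z ≤ M) :
    Integrable (outerF hℓ k) :=
  Integrable.mono' (integrable_indicator_closedBall _ _ _) (measurable_outerF hℓ k hk).aestronglyMeasurable
    (Eventually.of_forall (outerF_le hℓ k hk0 hkM))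

/-- **The outer floor**: `m · vol B̄(θc, ℓ/16) · vol B̄(c, ℓ/16) ≤ ∫ w I`. [this route] -/
theorem integral_outerF_ge (hk : Measurable k) (hk0 : ∀ z, 0 ≤ k z) (hkm : ∀ z ∈ W ℓ, m ≤ k z)
    (hkM : ∀ z ∈ W ℓ, k z ≤ M) :
    m * (volume : Measure E4).real (closedBall (timeReflection 4 (ctr ℓ)) (ℓ / 16)) *
      (volume : Measure E4).real (closedBall (ctr ℓ) (ℓ / 16)) ≤ ∫ x, outerF hℓ k x := by
  set M' : ℝ := m * (volume : Measure E4).real (closedBall (timeReflection 4 (ctr ℓ)) (ℓ / 16))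
    with hM'
  calc M' * (volume : Measure E4).real (closedBall (ctr ℓ) (ℓ / 16))
        = ∫ x, (closedBall (ctr ℓ) (ℓ / 16)).indicator (fun _ => M') x := by
        rw [integral_indicator_const _ measurableSet_closedBall, smul_eq_mul, mul_comm]
    _ ≤ ∫ x, outerF hℓ k x := by
        refine integral_mono (integrable_indicator_closedBall _ _ _)
          (integrable_outerF hℓ k hk hk0 hkM) fun x => ?_
        by_cases hx : x ∈ closedBall (ctr ℓ) (ℓ / 16)
        · rw [indicator_of_mem hx]
          have hb : bump ℓ hℓ x = 1 := (bump ℓ hℓ).one_of_mem_closedBall (by simpa using hx)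
          show M' ≤ outerF hℓ k x
          unfold outerF
          rw [hb, one_mul, hM']
          exact innerI_ge hℓ k hk hk0 hkm hkM hx
        · rw [indicator_of_notMem hx]
          exact outerF_nonneg hℓ k hk0 x

/-- **Wick form ↔ density form**: for ANY matrix covariance `G` with `tr G(z)G(−z) = k(z)`, the
reflected two-ring functional of the mode is the outer integral of the chain. [this route] -/
theorem ring2_eq_integral_outerF {G : E4 → Matrix (Fin 6) (Fin 6) ℝ}
    (hG : ∀ z, (G z * G (-z)).trace = k z) :
    (∫ x, ∫ y, wfun ℓ hℓ x * thetaTest 4 (wfun ℓ hℓ) y * (G (x - y) * G (y - x)).trace) =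
      ∫ x, outerF hℓ k x := by
  refine integral_congr_ae (Eventually.of_forall fun x => ?_)
  show (∫ y, wfun ℓ hℓ x * thetaTest 4 (wfun ℓ hℓ) y * (G (x - y) * G (y - x)).trace) =
    outerF hℓ k x
  unfold outerF innerI
  rw [← integral_const_mul]
  refine integral_congr_ae (Eventually.of_forall fun y => ?_)
  show wfun ℓ hℓ x * thetaTest 4 (wfun ℓ hℓ) y * (G (x - y) * G (y - x)).trace =
    bump ℓ hℓ x * dens2 hℓ k x y
  rw [thetaTest_apply, wfun_apply, wfun_apply, dens2, ← hG (x - y), neg_sub]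
  ring

/-- **The generic floor**: `m (ℓ/16)⁸ vol(B₁)² ≤ ∫∫ w (θw) tr G G`. [this route] -/
theorem ring2_floor (hk : Measurable k) (hk0 : ∀ z, 0 ≤ k z) (hkm : ∀ z ∈ W ℓ, m ≤ k z)
    (hkM : ∀ z ∈ W ℓ, k z ≤ M) {G : E4 → Matrix (Fin 6) (Fin 6) ℝ}
    (hG : ∀ z, (G z * G (-z)).trace = k z) :
    m * ((ℓ / 16) ^ 4 * (volume : Measure E4).real (ball 0 1)) *
        ((ℓ / 16) ^ 4 * (volume : Measure E4).real (ball 0 1)) ≤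
      ∫ x, ∫ y, wfun ℓ hℓ x * thetaTest 4 (wfun ℓ hℓ) y * (G (x - y) * G (y - x)).trace := by
  rw [ring2_eq_integral_outerF hℓ k hG]
  have h := integral_outerF_ge hℓ k hk hk0 hkm hkM
  rwa [volume_real_closedBall _ (by positivity : (0:ℝ) ≤ ℓ / 16),
    volume_real_closedBall _ (by positivity : (0:ℝ) ≤ ℓ / 16)] at h

end Chain

end Summit.QuantumFields.YangMills.Theorems.ThermalDescent.MaxwellRung

end
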